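import Summits.ValiantsHypothesis.ValiantsHypothesis.Theorems.LacunarySymmetroidMatrixDescartesChainLadder
import Summits.ValiantsHypothesis.ValiantsHypothesis.Theorems.LacunarySymmetroidMatrixDescartesCensusM2K7C22

/-!
# `MatrixDescartes` census — the CHAIN-LADDER RAYS of the certified row `M2K7C22`: `ζ_sym(2, 6(j+1)+1+i) ≥ 22(j+1) + 2·i`

HONEST FRAMING.  Object-search cell `pub-symmetroid`, crux `Theses.LacunarySymmetroid.MatrixDescartes`
(stmt-ValiantsHypothesis-18050); seat val-sym-mdr-p1 (g8).  LOWER-bound rows in census (CONJECTURE-A) currency; nothing about the crux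
`MatrixDescartes` (upper bound at fat formats), `DoorA26` / `DoorA34`, or `VP ≠ VNP`.  No definitions.

The typer's kernel certificate `Census.M2K7C22` (`ζ_sym(2,7) ≥ 22`: closed form `Census.M2K7C22.eval_det` + sign alternation at 23 rational
points) is fed — with the SAME certificate data and tactic blocks, re-checked here once — to the CHAIN LADDER in certificate form
(`Chain.not_posRootLawAt_ladder_add_of_certificate`: chaining the certificate with its own `x ↦ 1/x` reversal `j` times multiplies the
alternation count by `j+1` at the price of `6` letters per copy, and each of `i` grafted letters buys `m = 2` more), giving the
two-parameter family `ray (j i) : ¬ PosRootLawAt 2 ((j+1)·6 + 1 + i) ((j+1)·22 + i·2 − 1)` and numeral instances.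
[folklore] (intermediate value theorem; certificate arithmetic by `norm_num`, heartbeat budget as in the source certificate file).
-/

-- `Summit.ValiantsHypothesis.ValiantsHypothesis.…` repeats a component by the D-0017 layout
-- (single-conjunct summit), which the `dupNamespace` linter flags; the name is mandated.
set_option linter.dupNamespace false

namespace Summit.ValiantsHypothesis.ValiantsHypothesis.Theorems.LacunarySymmetroidMatrixDescartes.Census.Chain.RayM2K7C22

open Summit.ValiantsHypothesis.ValiantsHypothesis.Theorems.MatrixDescartes.Negative (PosRootLawAt)
open scoped BigOperators Matrix

-- 23 + 22 exact evaluations of the certificate's closed form exceed the default heartbeat budget (as in `Census.M2K7C22`).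
set_option maxHeartbeats 40000000 in
set_option exponentiation.threshold 3701 in
/-- **The chain-ladder rays of `M2K7C22`**: for every `j, i`, `ζ_sym(2, 6(j+1)+1+i) ≥ 22(j+1) + 2i` —
`¬ PosRootLawAt 2 ((j+1)·6 + 1 + i) ((j+1)·22 + i·2 − 1)` (the certified `22`-alternation row laddered `j` times and grafted `i` times).
[folklore] -/
theorem ray (j i : ℕ) : ¬ PosRootLawAt 2 ((j + 1) * 6 + 1 + i) ((j + 1) * 22 + i * 2 - 1) :=
  Summit.ValiantsHypothesis.ValiantsHypothesis.Theorems.LacunarySymmetroidMatrixDescartes.Census.Chain.not_posRootLawAt_ladder_add_of_certificate (N := 22)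
    Summit.ValiantsHypothesis.ValiantsHypothesis.Theorems.LacunarySymmetroidMatrixDescartes.Census.M2K7C22.eval_det
    (by intro l; fin_cases l <;> (unfold Matrix.IsSymm; ext i j; fin_cases i <;> fin_cases j <;> rfl))
    (![1/549755813888, 1/137438953472, 1/64, 33/1024, 17/512, 5/128, 3/64, 1/16, 3/32, 1/8, 13/64, 1/4, 9/32, 19/64, 5/16, 21/64, 11/32, 89/256, 45/128, 3/8, 1/2, 2, 32] : Fin 23 → ℝ)
    (by
      refine Fin.strictMono_iff_lt_succ.2 fun j => ?_
      fin_cases j <;> simp only [Fin.castSucc_mk, Fin.succ_mk] <;> norm_num)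
    (by intro j; fin_cases j <;> norm_num)
    (by intro j; fin_cases j <;> simp only [Fin.castSucc_mk, Fin.succ_mk] <;> norm_num)
    (by norm_num) j i

/-- `ζ_sym(2,13) ≥ 44` (certificate `M2K7C22` laddered `1` time(s), grafted `0` time(s)). [folklore] -/
theorem row_2_13 : ¬ PosRootLawAt 2 13 43 := by
  have h := ray 1 0
  norm_num at h
  exact h

/-- `ζ_sym(2,14) ≥ 46` (certificate `M2K7C22` laddered `1` time(s), grafted `1` time(s)). [folklore] -/
theorem row_2_14 : ¬ PosRootLawAt 2 14 45 := by
  have h := ray 1 1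
  norm_num at h
  exact h

/-- `ζ_sym(2,19) ≥ 66` (certificate `M2K7C22` laddered `2` time(s), grafted `0` time(s)). [folklore] -/
theorem row_2_19 : ¬ PosRootLawAt 2 19 65 := by
  have h := ray 2 0
  norm_num at h
  exact h

/-- `ζ_sym(2,25) ≥ 88` (certificate `M2K7C22` laddered `3` time(s), grafted `0` time(s)). [folklore] -/
theorem row_2_25 : ¬ PosRootLawAt 2 25 87 := by
  have h := ray 3 0
  norm_num at h
  exact h

end Summit.ValiantsHypothesis.ValiantsHypothesis.Theorems.LacunarySymmetroidMatrixDescartes.Census.Chain.RayM2K7C22
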